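import Summits.Ventures.YMGap.RobustBall.AxialTowerMember
import Summits.Ventures.YMGap.RobustBall.RobustAreaLawVertexW
import HarnessLib

/-!
# RobustBall/AxialTowerAreaLaw — an explicit INFINITE-RANGE perturbation of the `SU(2)` Wilson action with a kernel-proved AREA LAW
(cell `pub-ymgap`, track Y2 ROBUST-BALL; ds-4)

HONEST FRAMING: strong-coupling finite-lattice statement (β_W = 1/3, inside the Osterwalder–Seiler window); the composition of this seat's
tier-2 area law (`su2_areaLawOnBallW_vertex_oneThird_w65`, vertex row `(1/3, log(6/5), 7/50)`) with the axial-tower witness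
(`towerWitness_mem_clusterDomain`, `isSlabLocal_towerWitness`, `towerWitness_not_mem_clusterDomainFR`): for `|τ| ≤ 1/6000` and decay
ratio `θ = 1/2` the axial-tower action — `SU(2)`, `d = 4`, every plaquette coupled to ALL its axial translates `p + s e_k` with coefficient
`τ/2^{s+1}` — lies in `ClusterDomain (log 6/5) (7/25) (7/50) ∩ IsSlabLocal 2` on EVERY torus, so its rectangular Wilson loops obey ONE area law
`|⟨W_{R×T}⟩| ≤ C^{2(R+T)} e^{−cRT}` with constants independent of `L` and `τ` (`su2_towerWitness_areaLaw`); and for `τ > 0` it is in NO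
tier-1 ball `ClusterDomainFR ε₀ ε₁ r` once `L ≥ 2(r+1)`.  Nothing about the continuum limit or Clay.
-/

noncomputable section

open MeasureTheory Finset Function
open Literature.Probability.LatticeModels Literature.Probability.LatticeModels.DobrushinMetric
open Literature.MathematicalPhysics.QuantumLattice hiding torusNorm
open Literature.MathematicalPhysics.QuantumFieldTheory hiding ZdEdge

namespace Summit.Ventures.YMGap.RobustBall

variable {L : ℕ} [NeZero L]

/-- `√2 ≥ 1.4`. [folklore] -/
theorem sqrt_two_ge_14 : (14 / 10 : ℝ) ≤ Real.sqrt 2 := by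
  rw [show (14 / 10 : ℝ) = Real.sqrt ((14 / 10) ^ 2) by rw [Real.sqrt_sq (by norm_num)]]
  exact Real.sqrt_le_sqrt (by norm_num)

/-- **The `SU(2)`, `d = 4` axial-tower action with `|τ| ≤ 1/6000`, `θ = 1/2` is in the vertex-row ball `ClusterDomain (log 6/5) (7/25) (7/50)`**
on every torus: loads `86.4|τ| ≤ 0.0144 ≤ 7/25` and `1036.8|τ|/√2 ≤ 0.124 ≤ 7/50`. [folklore] -/
theorem su2_towerWitness_mem_clusterDomain {τ : ℝ} (hτ : |τ| ≤ 1 / 6000) :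
    towerWitness 4 L 2 τ (1 / 2) ∈ ClusterDomain (Real.log (6 / 5)) (7 / 25) (7 / 50) := by
  have hexp : Real.exp (Real.log (6 / 5)) = 6 / 5 := Real.exp_log (by norm_num)
  have hκ : 0 ≤ Real.log (6 / 5) := Real.log_nonneg (by norm_num)
  have hq : Real.exp (Real.log (6 / 5)) * (1 / 2) < 1 := by rw [hexp]; norm_num
  have hmem := towerWitness_mem_clusterDomain (d := 4) (L := L) 2 τ (1 / 2) (Real.log (6 / 5)) (by norm_num) hκ (by norm_num) hq
  rw [hexp] at hmem
  refine clusterDomain_mono le_rfl ?_ ?_ hmem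
  · have h0 : 0 ≤ |τ| := abs_nonneg τ
    norm_num
    nlinarith
  · have hs := sqrt_two_ge_14
    have hs0 : 0 < Real.sqrt 2 := lt_of_lt_of_le (by norm_num) hs
    have h1 : |τ| / Real.sqrt ((2 : ℕ) : ℝ) ≤ (1 / 6000) / (14 / 10) := by
      rw [Nat.cast_ofNat, div_le_div_iff₀ hs0 (by norm_num)]
      have h0 : 0 ≤ |τ| := abs_nonneg τ
      nlinarith
    norm_num at h1 ⊢
    nlinarith [h1]

/-- **AN INFINITE-RANGE PERTURBATION WITH A PROVED AREA LAW.**  There are constants `C, c > 0` such that for EVERY torus `(ℤ/L)⁴`, every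
coupling `|τ| ≤ 1/6000`, and every rectangular `R × T` loop with `2R, 2T ≤ L`, the Wilson-loop expectation under the `SU(2)` measure at
`β_W = 1/3` (tree coupling `1/6`) perturbed by the axial-tower action (all axial plaquette pairs, coefficient `τ/2^{s+1}` at separation `s`)
satisfies `|⟨W_{R×T}⟩| ≤ C^{2(R+T)} e^{−cRT}` — the tier-2 vertex row `su2_areaLawOnBallW_vertex_oneThird_w65` applied to the member
`su2_towerWitness_mem_clusterDomain` / `isSlabLocal_towerWitness`. [folklore] -/
theorem su2_towerWitness_areaLaw :
    ∃ C c : ℝ, 0 < c ∧ ∀ (L : ℕ) [NeZero L] (τ : ℝ), |τ| ≤ 1 / 6000 →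
      ∀ (x : Site 4 L) (i j : Fin 4) (R T : ℕ), i ≠ j → 1 ≤ R → 1 ≤ T → 2 * R ≤ L → 2 * T ≤ L →
        |(towerWitness 4 L 2 τ (1 / 2)).expectation (fundamentalRep (Fin 2)) (1 / 6)
            (wilsonLoop (fundamentalRep (Fin 2)) x i j R T)| ≤ C ^ (2 * (R + T)) * Real.exp (-c * (R * T)) := by
  obtain ⟨C, c, hc, h⟩ := su2_areaLawOnBallW_vertex_oneThird_w65 (mv := 2) (by norm_num)
  exact ⟨C, c, hc, fun L _ τ hτ x i j R T hij hR hT hRL hTL =>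
    h L _ (su2_towerWitness_mem_clusterDomain hτ) (isSlabLocal_towerWitness 2 τ (1 / 2)) x i j R T hij hR hT hRL hTL⟩

/-- **… and the perturbation is in no tier-1 ball**: for `0 < τ` and every range `r`, radii `ε₀, ε₁`, torus size `L ≥ 2(r+1)`:
`towerWitness 4 L 2 τ (1/2) ∉ ClusterDomainFR ε₀ ε₁ r`. [folklore] -/
theorem su2_towerWitness_not_tierOne {τ : ℝ} (hτ : 0 < τ) (ε₀ ε₁ : ℝ) {r : ℕ} (hr : 2 * (r + 1) ≤ L) :
    towerWitness 4 L 2 τ (1 / 2) ∉ ClusterDomainFR ε₀ ε₁ r :=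
  towerWitness_not_mem_clusterDomainFR 2 τ (1 / 2) (by norm_num) hτ (by norm_num)
    ⟨((0 : Fin 4), (1 : Fin 4), (2 : Fin 4)), by decide⟩ ε₀ ε₁ hr

end Summit.Ventures.YMGap.RobustBall

end
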